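/-
Copyright (c) 2026 the pub-hodgecm-mathlib formalisation cell (harness21).  Prover seat hodgecm-mathlib-R90-CS-p03 (g0), R90-TF section S8 «ContSpec-n½» (dealer R90-CS-plan (g2),
deal S8-R53 «B2», census `R90/S8/CENSUS-B2.R90-CS-p03-g0.md`): the coordinate-side JUNCTION of the unramified `χ`-scalar of `U(2,1)_{L∕L⁺}` — regrouping the `L`-places over the
`L⁺`-places, the per-place token algebra (inert ∕ split), and «the `T`-partial product of the local `χ`-means is F4's `c_χ^S(z)`».
-/
import Summits.HodgeConjecture.HodgeConjecture.Theorems.K2E1ChiIntertwiningScalarEulerQuotientU3   -- ★ F4 (this seat): `hasProd_chiLocalScalarE`, `hasProd_chiLocalScalarF` (the two Euler products of the local shapes)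
import Literature.NumberTheory.Automorphic.PairLFunctionBaseChange                                 -- ★ `placesNotOverEquivSigma` (Arthur–Clozel Ch. 3 L. 4.3 regrouping `{w ∕∕ w ∩ 𝓞F ∉ T} ≃ Σ (v ∉ T), {w ∣ v}`), `residueCard_eq_pow_inertiaDeg`
import Literature.NumberTheory.Automorphic.UnitaryGroupLocalFactors                                -- ★ `UnitaryGroup.PlacesOver E v` + its (noncomputable) `Fintype` instance
import HarnessLib

/-!
# K2·E1 ∕ R90·S8 — `K2E1ChiIntertwiningScalarEulerJunctionU3` (file B2): THE COORDINATE↔SCALAR JUNCTION OF THE UNRAMIFIED `χ`-SCALAR OF `U(2,1)_{L∕L⁺}` —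
# REGROUPING `∏'_{w ∉ S_E} = ∏'_{v ∉ T} ∏_{w ∣ v}`, THE INERT ∕ SPLIT TOKEN ALGEBRA, AND «`∏'_{v ∉ T}` (local `χ`-mean at `v`) `= c_χ^S(z)`» ON `{2 < Re z}`

Cell `pub/hodgecm-mathlib`, crux h413 = `stmt-HodgeConjecture-24833`, route of record `HCCMUnconditional`; R90-TF section S8 «ContSpec-n½» (file B ED. 4: #3 :409, #2♯ :433), roads
R2-χ₃ ∕ R4-χ₃ (`R90/S8/ROAD-S8B2.K2E1-p13-g3.md`), censuses `CENSUS-sock3-piN.R90-C10-p07-g0.md` §B1∕B2 and `CENSUS-B2.R90-CS-p03-g0.md`.  THEOREMS ONLY (no `def`, no `instance`, no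
notation, no named-fact hypothesis, no `sorry`; default heartbeats); lane `--supports stmt-HodgeConjecture-24833 --as helper` (count-neutral).  Closes no socket.

THE MATHEMATICS ([Rogawski1990, §13.9 p. 229]; [ArthurClozelAMS120, Ch. 3 Lemma 4.3]; [Langlands1976, Appendix]).  ★ F4 `K2E1ChiIntertwiningScalarEulerQuotientU3` writes the unramified
`χ`-scalar of the standard intertwining operator of `U(2,1)_{E∕F}` (`E = L`, `F = L⁺`; Borel datum `χ = (φ, ψ)`, `φ` a unitary Hecke character of `E`, `η = φ′·ω_{E∕F}` one of `F`) as
  `c_χ^S(z) = [P_E(z−1;φ)·P_F(2z−2;η)] ∕ [P_E(z;φ)·P_F(2z−1;η)]`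
with `P_E` an Euler product over the places `w` of `E` OUTSIDE `S` and `P_F` one over the places `v` of `F` outside `T`, and proves (§1 there) that `P_E(z−1)∕P_E(z)` is the `HasProd` of the
SHORT-ROOT shapes `(1 − φ_w N_w^{−z})(1 − φ_w N_w^{−(z−1)})⁻¹` over `w ∉ S` and `P_F(2z−2)∕P_F(2z−1)` that of the LONG-ROOT shapes `(1 − η_v q_v^{−(2z−1)})(1 − η_v q_v^{−(2z−2)})⁻¹` over `v ∉ T`.
The local harmonic analysis (B1-local ★ `K2E1ChiIntertwiningLocalScalarU3`, split sequel `K2E1ChiIntertwiningLocalScalarSplitU3`) produces ONE number per place `v` of `F` — the local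
`χ`-mean — so the scalar must be read over the places of `F`: THIS FILE does the bookkeeping.
* §1 **REGROUPING** (any extension `E ∕ F` of number fields, any `f`, any `T`): a `HasProd` over the `E`-places `w` with `w ∩ 𝓞F ∉ T` is a `HasProd` over the `F`-places `v ∉ T` of the
  FINITE products `∏_{w ∣ v} f w` (★ `placesNotOverEquivSigma` — Arthur–Clozel's Lemma 4.3 regrouping, in tree — and Mathlib `HasProd.sigma`): `hasProd_placesOver_of_hasProd`.
* §2 **THE JUNCTION WITH ★ F4**: for `2 < Re z`, `HasProd (v ∉ T ↦ (∏_{w ∣ v} E-shape_w(z))·F-shape_v(z)) (c_χ^S(z))` with `S := {w ∣ w ∩ 𝓞F ∈ T}` — `hasProd_placesOver_eShape_mul_fShape`.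
* §3 **THE PER-PLACE TOKENS** (pure algebra in `q^{−z}` under the print's place letters, which the assembly discharges): at an INERT good `v` (`w ∣ v` unique, `N_w = q_v²`, `η_v = −e`,
  `e = φ_w(ϖ_w)`) the bracket is `(1 − e·q^{−2z})(1 + e·q^{−(2z−1)}) ∕ ((1 − e·q^{−(2z−2)})(1 + e·q^{−(2z−2)}))` = ★ B1-local's token `chiLocalMean_eq_token_of_shell_nonsplit` VERBATIM
  (`prod_placesOver_eShape_mul_fShape_of_inert`); at a SPLIT good `v` (`w₁ ≠ w₂ ∣ v`, `N = q_v`, `η_v = e₁e₂`) it is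
  `(1 − e₁q^{−z})(1 − e₂q^{−z})(1 − e₁e₂q^{−(2z−1)}) ∕ ((1 − e₁q^{−(z−1)})(1 − e₂q^{−(z−1)})(1 − e₁e₂q^{−(2z−2)}))` = the two-exponent Gindikin–Karpelevich token of the split sequel
  (K2E1-p13 census ffcf7d3b, R90-C10-p07 HEADS 22:36:18Z, with `(u₁,u₂) = (e₁,e₂)`; their `e₁e₂ = 1` is the special case `η_v = 1`) (`prod_placesOver_eShape_mul_fShape_of_split`).
* §4 **LOCAL MEANS BY NAME-SHAPE**: for any family `m : places(F) → ℂ` with `m v = (∏_{w ∣ v} E-shape_w(z))·F-shape_v(z)` off `T`: `HasProd (v ∉ T ↦ m v) (c_χ^S(z))` and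
  `∏'_{v ∉ T} m v = c_χ^S(z)` — `hasProd_localMeans_eq_chiScalar`, `tprod_localMeans_eq_chiScalar`.  The assembly (the `χ`-twin of ★ `K2E1IntertwiningScalarEulerProductU3`) feeds `hm`
  place by place from §3 + the local files; B1-local is NOT imported here (its binders `ν δ hcδ hδ h2 hδu ω hshell` are per-place DATA of the assembly).
HONEST SCOPE: no local identification, no archimedean∕bad-place factors, no discharge of the place letters `hsub∕hall∕hN∕hηv` (they are ★ `PlacesOver.subsingleton_of_smul_eq`, ★
`residueCard_eq_pow_inertiaDeg` with `f = 2 ∕ 1`, and `η = φ′ω` bookkeeping — the assembly's), nothing at `Re z ≤ 2`.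
HONEST LABEL: HC_CM is proved only modulo the 7 printed citations (2 remaining named inputs: hLiu418 = `stmt-HodgeConjecture-24832`, h413 = `stmt-HodgeConjecture-24833`) until rung 0
closes; REL ≠ ★ ≠ BUILT; count-neutral helper; closes no socket.

## References
* [Rogawski1990] J. D. Rogawski, *Automorphic Representations of Unitary Groups in Three Variables*, Ann. of Math. Stud. 123 (1990): §13.9 p. 229 (`M(s)`).
* [ArthurClozelAMS120] J. Arthur, L. Clozel, *Simple Algebras, Base Change, and the Advanced Theory of the Trace Formula*, Ann. of Math. Stud. 120 (1989): Ch. 3, Lemma 4.3 (regrouping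
  an Euler product over `E` by the places of `F`).
* [Langlands1976] R. P. Langlands, *On the Functional Equations Satisfied by Eisenstein Series*, LNM 544 (1976): Appendix (rank one).
* [NeukirchANT1999] J. Neukirch, *Algebraic Number Theory* (1999): Ch. I §8 (`q_w = q_v^{f(w∣v)}`), Ch. VII §8.
-/

set_option autoImplicit false
set_option linter.dupNamespace false  -- the mandated namespace repeats the summit's segment (`HodgeConjecture.HodgeConjecture`)

noncomputable section

open scoped NNReal
open Filter Topology Complex NumberField IsDedekindDomain
open Literature.NumberTheory.Automorphic Literature.NumberTheory.Automorphic.UnitaryGroup Literature.NumberTheory.LFunctions Literature.NumberTheory.GaloisRepresentations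
open Summit.HodgeConjecture.HodgeConjecture.Cruxes.H413.K2E1ChiIntertwiningScalarEulerQuotientU3 (hasProd_chiLocalScalarE hasProd_chiLocalScalarF)

namespace Summit.HodgeConjecture.HodgeConjecture.Cruxes.H413.K2E1ChiIntertwiningScalarEulerJunctionU3

variable {E : Type} [Field E] [NumberField E] {F : Type} [Field F] [NumberField F] [Algebra F E]

/-! ## §1 Regrouping an Euler product over `E` by the places of `F` below -/

/-- **REGROUPING `∏'_{w : w ∩ 𝓞F ∉ T} f(w) = ∏'_{v ∉ T} ∏_{w ∣ v} f(w)`** (as `HasProd`s): a product over the places `w` of `E` lying over places of `F` outside `T` that `HasProd`-converges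
to `a` converges, regrouped by the place `v = w ∩ 𝓞F` below, to the same `a`, the inner products over the finitely many `w ∣ v` being finite (★ `placesNotOverEquivSigma`, Mathlib
`HasProd.sigma`). [cite: ArthurClozelAMS120, Ch. 3 Lemma 4.3] [cite: NeukirchANT1999, Ch. I §8] -/
theorem hasProd_placesOver_of_hasProd {T : Set (HeightOneSpectrum (𝓞 F))} {f : HeightOneSpectrum (𝓞 E) → ℂ} {a : ℂ}
    (h : HasProd (fun w : {w : HeightOneSpectrum (𝓞 E) // w.under (𝓞 F) ∉ T} => f w.1) a) :
    HasProd (fun v : {v : HeightOneSpectrum (𝓞 F) // v ∉ T} => ∏ w : PlacesOver E v.1, f w.1) a := by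
  have h' : HasProd ((fun w : {w : HeightOneSpectrum (𝓞 E) // w.under (𝓞 F) ∉ T} => f w.1) ∘ (placesNotOverEquivSigma (E := E) T)) a :=
    (Equiv.hasProd_iff (placesNotOverEquivSigma (E := E) T)).mpr h
  exact h'.sigma fun v => hasProd_fintype _

/-! ## §2 The junction with ★ F4: `HasProd` over the places of `F` of the regrouped short-root shapes times the long-root shape -/

section Junction

variable {φ : HeckeCharacter E} {η : HeckeCharacter F} {T : Set (HeightOneSpectrum (𝓞 F))}

/-- **THE JUNCTION — `∏'_{v ∉ T} [(∏_{w ∣ v} E-shape_w(z)) · F-shape_v(z)] = c_χ^S(z)`, `Re z > 2`**, as a `HasProd`, where `S := {w ∣ w ∩ 𝓞F ∈ T}` and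
`c_χ^S(z) = [P_E(z−1;φ)·P_F(2z−2;η)] ∕ [P_E(z;φ)·P_F(2z−1;η)]` is ★ F4's quotient term at that `S`: ★ `hasProd_chiLocalScalarE` regrouped by §1, multiplied by ★ `hasProd_chiLocalScalarF`
(`div_mul_div_comm`).  Here E-shape_w(z) `= (1 − φ_w N_w^{−z})(1 − φ_w N_w^{−(z−1)})⁻¹`, F-shape_v(z) `= (1 − η_v q_v^{−(2z−1)})(1 − η_v q_v^{−(2z−2)})⁻¹`.
[cite: Rogawski1990, §13.9 p. 229] [cite: ArthurClozelAMS120, Ch. 3 Lemma 4.3] -/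
theorem hasProd_placesOver_eShape_mul_fShape (hφ : φ.IsUnitary) (hη : η.IsUnitary) {z : ℂ} (hz : 2 < z.re) :
    HasProd (fun v : {v : HeightOneSpectrum (𝓞 F) // v ∉ T} =>
        (∏ w : PlacesOver E v.1, (1 - φ.valueAtUniformizer w.1 * (w.1.residueCard : ℂ) ^ (-z)) * (1 - φ.valueAtUniformizer w.1 * (w.1.residueCard : ℂ) ^ (-(z - 1)))⁻¹) *
          ((1 - η.valueAtUniformizer v.1 * (v.1.residueCard : ℂ) ^ (-(2 * z - 1))) * (1 - η.valueAtUniformizer v.1 * (v.1.residueCard : ℂ) ^ (-(2 * z - 2)))⁻¹))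
      ((partialStandardL {w : HeightOneSpectrum (𝓞 E) | w.under (𝓞 F) ∈ T} (fun w => {φ.valueAtUniformizer w}) (z - 1) *
          partialStandardL T (fun v => {η.valueAtUniformizer v}) (2 * z - 2)) /
        (partialStandardL {w : HeightOneSpectrum (𝓞 E) | w.under (𝓞 F) ∈ T} (fun w => {φ.valueAtUniformizer w}) z *
          partialStandardL T (fun v => {η.valueAtUniformizer v}) (2 * z - 1))) := by
  have hE : HasProd (fun w : {w : HeightOneSpectrum (𝓞 E) // w.under (𝓞 F) ∉ T} =>
      (1 - φ.valueAtUniformizer w.1 * (w.1.residueCard : ℂ) ^ (-z)) * (1 - φ.valueAtUniformizer w.1 * (w.1.residueCard : ℂ) ^ (-(z - 1)))⁻¹)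
      (partialStandardL {w : HeightOneSpectrum (𝓞 E) | w.under (𝓞 F) ∈ T} (fun w => {φ.valueAtUniformizer w}) (z - 1) /
        partialStandardL {w : HeightOneSpectrum (𝓞 E) | w.under (𝓞 F) ∈ T} (fun w => {φ.valueAtUniformizer w}) z) :=
    (hasProd_chiLocalScalarE (S := {w : HeightOneSpectrum (𝓞 E) | w.under (𝓞 F) ∈ T}) hφ hz).1
  have hE' := hasProd_placesOver_of_hasProd (E := E) (F := F) (T := T)
    (f := fun w : HeightOneSpectrum (𝓞 E) => (1 - φ.valueAtUniformizer w * (w.residueCard : ℂ) ^ (-z)) * (1 - φ.valueAtUniformizer w * (w.residueCard : ℂ) ^ (-(z - 1)))⁻¹) hE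
  have hF := (hasProd_chiLocalScalarF (T := T) hη (show 3 / 2 < z.re by linarith)).1
  have h := hE'.mul hF
  rw [div_mul_div_comm] at h
  exact h

/-! ## §3 The per-place tokens: inert and split good places (pure algebra in `q^{−z}` under the place letters) -/

/-- `((q : ℂ)²)^s = q^{2s}` for a natural number `q` (principal branch; `arg q = 0`). [folklore] -/
theorem natCast_sq_cpow (q : ℕ) (s : ℂ) : ((q : ℂ) ^ 2) ^ s = (q : ℂ) ^ (2 * s) := by
  have him : (Complex.log (q : ℂ) * 2).im = 0 := by
    simp [Complex.mul_im, Complex.log_im, Complex.natCast_arg]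
  rw [← Complex.cpow_two, ← Complex.cpow_mul s (by rw [him]; exact neg_lt_zero.mpr Real.pi_pos) (by rw [him]; exact Real.pi_pos.le)]

/-- **THE INERT TOKEN**: at a good place `v` of `F` INERT in `E` — a unique `w ∣ v` (`hsub`), residue degree two `N_w = q_v²` (`hN`), `e := φ_w(ϖ_w)` and `η_v(ϖ_v) = −e` (`hηv`; for
`η = φ′ω`: `φ′(ϖ_v) = e`, `ω_v(ϖ_v) = −1`) — the bracket `(∏_{w ∣ v} E-shape_w(z))·F-shape_v(z)` equals
`(1 − e·q^{−2z})(1 + e·q^{−(2z−1)}) ∕ ((1 − e·q^{−(2z−2)})(1 + e·q^{−(2z−2)}))`, `q = q_v` — the token of ★ B1-local `K2E1ChiIntertwiningLocalScalarU3.chiLocalMean_eq_token_of_shell_nonsplit`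
letter for letter (the `v`-factor of `L(s,φ)L(2s,φ′ω)∕(L(s+1,φ)L(2s+1,φ′ω))` at `s = z − 1`, relative root system `(a, 2a)`).  The place letters are discharged by the assembly (★
`PlacesOver.subsingleton_of_smul_eq`, ★ `residueCard_eq_pow_inertiaDeg`). [cite: Rogawski1990, §13.9 p. 229] [cite: NeukirchANT1999, Ch. I §8] -/
theorem prod_placesOver_eShape_mul_fShape_of_inert {v : HeightOneSpectrum (𝓞 F)} (w : PlacesOver E v) (hsub : ∀ w' : PlacesOver E v, w' = w)
    (hN : w.1.residueCard = v.residueCard ^ 2) {e : ℂ} (he : φ.valueAtUniformizer w.1 = e) (hηv : η.valueAtUniformizer v = -e) (z : ℂ) :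
    (∏ w' : PlacesOver E v, (1 - φ.valueAtUniformizer w'.1 * (w'.1.residueCard : ℂ) ^ (-z)) * (1 - φ.valueAtUniformizer w'.1 * (w'.1.residueCard : ℂ) ^ (-(z - 1)))⁻¹) *
        ((1 - η.valueAtUniformizer v * (v.residueCard : ℂ) ^ (-(2 * z - 1))) * (1 - η.valueAtUniformizer v * (v.residueCard : ℂ) ^ (-(2 * z - 2)))⁻¹) =
      (1 - e * (v.residueCard : ℂ) ^ (-(2 * z))) * (1 + e * (v.residueCard : ℂ) ^ (-(2 * z - 1))) /
        ((1 - e * (v.residueCard : ℂ) ^ (-(2 * z - 2))) * (1 + e * (v.residueCard : ℂ) ^ (-(2 * z - 2)))) := by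
  haveI : Subsingleton (PlacesOver E v) := ⟨fun a b => (hsub a).trans (hsub b).symm⟩
  rw [Fintype.prod_subsingleton _ w, he, hηv]
  -- residue degree two: `N_w^{−s} = q_v^{−2s}`
  have hq : (w.1.residueCard : ℂ) = (v.residueCard : ℂ) ^ 2 := by rw [hN]; push_cast; ring
  have h1 : (w.1.residueCard : ℂ) ^ (-z) = (v.residueCard : ℂ) ^ (-(2 * z)) := by
    rw [hq, natCast_sq_cpow, show (2 : ℂ) * -z = -(2 * z) by ring]
  have h2 : (w.1.residueCard : ℂ) ^ (-(z - 1)) = (v.residueCard : ℂ) ^ (-(2 * z - 2)) := by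
    rw [hq, natCast_sq_cpow, show (2 : ℂ) * -(z - 1) = -(2 * z - 2) by ring]
  rw [h1, h2]
  -- keep the inverses of the linear factors as separate atoms on both sides (`ring` would merge `((1−a)(1+a))⁻¹` into `(1−a²)⁻¹`)
  simp only [neg_mul, sub_neg_eq_add, div_eq_mul_inv, mul_inv]
  ring

/-- **THE SPLIT TOKEN**: at a good place `v` of `F` SPLIT in `E` — exactly two places `w₁ ≠ w₂` above `v` (`hne`, `hall`), residue degree one `N_{w_i} = q_v` (`hN₁`, `hN₂`),
`e_i := φ_{w_i}(ϖ)` and `η_v(ϖ_v) = e₁e₂` (`hηv`; for `η = φ′ω`: `φ′(ϖ_v) = e₁e₂`, `ω_v(ϖ_v) = +1`) — the bracket `(∏_{w ∣ v} E-shape_w(z))·F-shape_v(z)` equals the two-exponent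
Gindikin–Karpelevich token `(1 − e₁q^{−z})(1 − e₂q^{−z})(1 − e₁e₂q^{−(2z−1)}) ∕ ((1 − e₁q^{−(z−1)})(1 − e₂q^{−(z−1)})(1 − e₁e₂q^{−(2z−2)}))` of the split sequel (`GL₃(F_v)`:
`L_v(s,φ_{w₁})L_v(s,φ_{w₂})L_v(2s,φ′ω)∕(L_v(s+1,φ_{w₁})L_v(s+1,φ_{w₂})L_v(2s+1,φ′ω))` at `s = z − 1`). [cite: Rogawski1990, §13.9 p. 229] [cite: NeukirchANT1999, Ch. I §8] -/
theorem prod_placesOver_eShape_mul_fShape_of_split {v : HeightOneSpectrum (𝓞 F)} (w₁ w₂ : PlacesOver E v) (hne : w₁ ≠ w₂) (hall : ∀ w' : PlacesOver E v, w' = w₁ ∨ w' = w₂)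
    (hN₁ : w₁.1.residueCard = v.residueCard) (hN₂ : w₂.1.residueCard = v.residueCard)
    {e₁ e₂ : ℂ} (he₁ : φ.valueAtUniformizer w₁.1 = e₁) (he₂ : φ.valueAtUniformizer w₂.1 = e₂) (hηv : η.valueAtUniformizer v = e₁ * e₂) (z : ℂ) :
    (∏ w' : PlacesOver E v, (1 - φ.valueAtUniformizer w'.1 * (w'.1.residueCard : ℂ) ^ (-z)) * (1 - φ.valueAtUniformizer w'.1 * (w'.1.residueCard : ℂ) ^ (-(z - 1)))⁻¹) *
        ((1 - η.valueAtUniformizer v * (v.residueCard : ℂ) ^ (-(2 * z - 1))) * (1 - η.valueAtUniformizer v * (v.residueCard : ℂ) ^ (-(2 * z - 2)))⁻¹) =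
      (1 - e₁ * (v.residueCard : ℂ) ^ (-z)) * (1 - e₂ * (v.residueCard : ℂ) ^ (-z)) * (1 - e₁ * e₂ * (v.residueCard : ℂ) ^ (-(2 * z - 1))) /
        ((1 - e₁ * (v.residueCard : ℂ) ^ (-(z - 1))) * (1 - e₂ * (v.residueCard : ℂ) ^ (-(z - 1))) * (1 - e₁ * e₂ * (v.residueCard : ℂ) ^ (-(2 * z - 2)))) := by
  classical
  have huniv : (Finset.univ : Finset (PlacesOver E v)) = {w₁, w₂} := by
    ext w'
    simp only [Finset.mem_univ, Finset.mem_insert, Finset.mem_singleton, true_iff]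
    exact hall w'
  have hprod : (∏ w' : PlacesOver E v, (1 - φ.valueAtUniformizer w'.1 * (w'.1.residueCard : ℂ) ^ (-z)) * (1 - φ.valueAtUniformizer w'.1 * (w'.1.residueCard : ℂ) ^ (-(z - 1)))⁻¹) =
      (1 - φ.valueAtUniformizer w₁.1 * (w₁.1.residueCard : ℂ) ^ (-z)) * (1 - φ.valueAtUniformizer w₁.1 * (w₁.1.residueCard : ℂ) ^ (-(z - 1)))⁻¹ *
        ((1 - φ.valueAtUniformizer w₂.1 * (w₂.1.residueCard : ℂ) ^ (-z)) * (1 - φ.valueAtUniformizer w₂.1 * (w₂.1.residueCard : ℂ) ^ (-(z - 1)))⁻¹) := by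
    rw [show (∏ w' : PlacesOver E v, (1 - φ.valueAtUniformizer w'.1 * (w'.1.residueCard : ℂ) ^ (-z)) * (1 - φ.valueAtUniformizer w'.1 * (w'.1.residueCard : ℂ) ^ (-(z - 1)))⁻¹) =
        ∏ w' ∈ ({w₁, w₂} : Finset (PlacesOver E v)), (1 - φ.valueAtUniformizer w'.1 * (w'.1.residueCard : ℂ) ^ (-z)) * (1 - φ.valueAtUniformizer w'.1 * (w'.1.residueCard : ℂ) ^ (-(z - 1)))⁻¹
        by rw [← huniv], Finset.prod_pair hne]
  rw [hprod, he₁, he₂, hηv, show (w₁.1.residueCard : ℂ) = (v.residueCard : ℂ) by rw [hN₁], show (w₂.1.residueCard : ℂ) = (v.residueCard : ℂ) by rw [hN₂]]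
  simp only [div_eq_mul_inv, mul_inv]
  ring

end Junction

/-! ## §4 Local means by name-shape: `∏'_{v ∉ T} m v = c_χ^S(z)` -/

section LocalMeans

variable {φ : HeckeCharacter E} {η : HeckeCharacter F} {T : Set (HeightOneSpectrum (𝓞 F))}

/-- **«THE `T`-PARTIAL PRODUCT OF THE LOCAL `χ`-MEANS IS `c_χ^S(z)`» (`Re z > 2`)**: for ANY family `m : places(F) → ℂ` which, at every `v ∉ T`, equals the bracket
`(∏_{w ∣ v} E-shape_w(z))·F-shape_v(z)` (fed place by place by §3 and the local files ★ B1-local ∕ the split sequel), `HasProd (v ∉ T ↦ m v) (c_χ^S(z))` (§2 + `HasProd.congr_fun`).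
[cite: Rogawski1990, §13.9 p. 229] [cite: Langlands1976, Appendix] [cite: ArthurClozelAMS120, Ch. 3 Lemma 4.3] -/
theorem hasProd_localMeans_eq_chiScalar (hφ : φ.IsUnitary) (hη : η.IsUnitary) {z : ℂ} (hz : 2 < z.re) (m : HeightOneSpectrum (𝓞 F) → ℂ)
    (hm : ∀ v : HeightOneSpectrum (𝓞 F), v ∉ T → m v =
      (∏ w : PlacesOver E v, (1 - φ.valueAtUniformizer w.1 * (w.1.residueCard : ℂ) ^ (-z)) * (1 - φ.valueAtUniformizer w.1 * (w.1.residueCard : ℂ) ^ (-(z - 1)))⁻¹) *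
        ((1 - η.valueAtUniformizer v * (v.residueCard : ℂ) ^ (-(2 * z - 1))) * (1 - η.valueAtUniformizer v * (v.residueCard : ℂ) ^ (-(2 * z - 2)))⁻¹)) :
    HasProd (fun v : {v : HeightOneSpectrum (𝓞 F) // v ∉ T} => m v.1)
      ((partialStandardL {w : HeightOneSpectrum (𝓞 E) | w.under (𝓞 F) ∈ T} (fun w => {φ.valueAtUniformizer w}) (z - 1) *
          partialStandardL T (fun v => {η.valueAtUniformizer v}) (2 * z - 2)) /
        (partialStandardL {w : HeightOneSpectrum (𝓞 E) | w.under (𝓞 F) ∈ T} (fun w => {φ.valueAtUniformizer w}) z *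
          partialStandardL T (fun v => {η.valueAtUniformizer v}) (2 * z - 1))) :=
  (hasProd_placesOver_eShape_mul_fShape hφ hη hz).congr_fun fun v => hm v.1 v.2

/-- **`∏'_{v ∉ T} m v = c_χ^S(z)`** (`tprod` form of `hasProd_localMeans_eq_chiScalar`), and the product is `Multipliable`. [cite: Rogawski1990, §13.9 p. 229] [cite: Langlands1976, Appendix] -/
theorem tprod_localMeans_eq_chiScalar (hφ : φ.IsUnitary) (hη : η.IsUnitary) {z : ℂ} (hz : 2 < z.re) (m : HeightOneSpectrum (𝓞 F) → ℂ)
    (hm : ∀ v : HeightOneSpectrum (𝓞 F), v ∉ T → m v =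
      (∏ w : PlacesOver E v, (1 - φ.valueAtUniformizer w.1 * (w.1.residueCard : ℂ) ^ (-z)) * (1 - φ.valueAtUniformizer w.1 * (w.1.residueCard : ℂ) ^ (-(z - 1)))⁻¹) *
        ((1 - η.valueAtUniformizer v * (v.residueCard : ℂ) ^ (-(2 * z - 1))) * (1 - η.valueAtUniformizer v * (v.residueCard : ℂ) ^ (-(2 * z - 2)))⁻¹)) :
    Multipliable (fun v : {v : HeightOneSpectrum (𝓞 F) // v ∉ T} => m v.1) ∧
      ∏' v : {v : HeightOneSpectrum (𝓞 F) // v ∉ T}, m v.1 =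
        (partialStandardL {w : HeightOneSpectrum (𝓞 E) | w.under (𝓞 F) ∈ T} (fun w => {φ.valueAtUniformizer w}) (z - 1) *
            partialStandardL T (fun v => {η.valueAtUniformizer v}) (2 * z - 2)) /
          (partialStandardL {w : HeightOneSpectrum (𝓞 E) | w.under (𝓞 F) ∈ T} (fun w => {φ.valueAtUniformizer w}) z *
            partialStandardL T (fun v => {η.valueAtUniformizer v}) (2 * z - 1)) :=
  let h := hasProd_localMeans_eq_chiScalar hφ hη hz m hm
  ⟨h.multipliable, h.tprod_eq⟩

end LocalMeans

end Summit.HodgeConjecture.HodgeConjecture.Cruxes.H413.K2E1ChiIntertwiningScalarEulerJunctionU3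

end
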